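import Summits.Ventures.PercRepro.S2ThirteenSix
import Summits.Ventures.PercRepro.S2ClusterRows

/-!
# PercRepro — S2: THE CELL `(13, 6)` MODULO THE SPREAD ROWS `t ≤ 5` OF ITS COLOOP-FREE CASE (p7, gen 15; sub-claim S2)

`c025_core_five_thirteen_six_of_rows` with both row hypotheses discharged by the cluster lever: the `(13, 6)` spread rows
`t = 6, 7, 8` (`c025_thirteen_six_cf_spread_ge_six`) and the scaled `(12, 6)` rows `t = 6, 7, 8`
(`c025_twelve_six_cfk1_spread_six_to_eight`). What remains of the cell `(13, 6)` is exactly the hypothesis `hcf5`: the spread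
case of the coloop-free cell at `t ≤ 5` triangles (priced `1.08 … 1.12` with every lever in the tree). **`c025_core_five_thirteen_six_of_five`**.
NO cell and NO window move is claimed: the window of record is `8 ≤ p ≤ 14` (ADDENDUM 99). Axioms: standard.
-/

open scoped Matroid

namespace PercRepro

namespace ThmN

open Set

variable {α : Type}

/-- **The cell `(13, 6)` modulo the spread rows `t ≤ 5` of its coloop-free case.** -/
theorem c025_core_five_thirteen_six_of_five
    (hcf5 : ∀ (M : Matroid α) [M.Finite], M.eRank = ((13 : ℕ) : ℕ∞) → M.E.ncard = 13 + 6 →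
      (∀ e ∈ M.E, ∃ A ⊆ M.E \ {e}, e ∉ M.closure A ∧ e ∉ M.closure ((M.E \ {e}) \ A)) → (∀ e, ¬ M.IsColoop e) →
      ¬ (∃ W ⊆ M.E, W.ncard ≤ 9 ∧ W.encard = M.eRk W + 4) →
      {C : Set α | M.IsCircuit C ∧ C.ncard = 3}.ncard ≤ 5 → RLS M 13 5)
    (M : Matroid α) [M.Finite]
    (hR : M.eRank = ((13 : ℕ) : ℕ∞)) (hn : M.E.ncard = 13 + 6)
    (hfree : ∀ e ∈ M.E, ∃ A ⊆ M.E \ {e}, e ∉ M.closure A ∧ e ∉ M.closure ((M.E \ {e}) \ A)) : RLS M 13 5 := by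
  refine c025_core_five_thirteen_six_of_rows ?_ ?_ M hR hn hfree
  · intro M _ hR hn hfree hK h4 ht8
    by_cases ht5 : {C : Set α | M.IsCircuit C ∧ C.ncard = 3}.ncard ≤ 5
    · exact hcf5 M hR hn hfree hK h4 ht5
    · exact c025_thirteen_six_cf_spread_ge_six M hR hn hfree hK h4 (by omega)
  · intro M _ hR hn hfree hK h4 ht6 ht8
    exact c025_twelve_six_cfk1_spread_six_to_eight M hR hn hfree hK h4 ht6 ht8

end ThmN

end PercRepro
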